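import Literature.Computability.Cryptography.LWEPrimePowerProgOps
import Literature.Computability.Complexity.CodeFPStrings
import HarnessLib

/-!
# The Micciancio–Peikert machine, V: reading the answer history on lists

Topic `Computability/Cryptography` (LWE), grouping namespace `LWE.MP12.Prog`, sequel of
`LWEPrimePowerProgOps.lean`. Proved material (no named fact) towards
`Literature.Computability.Cryptography.blprs_gapSVP_sqrt_dim_to_lwe_classical` (**pqc.S21**),
hypothesis `h₂`: the quantities the adaptive strategy reads off the answer-bit history, at the list
level with polynomial-time realisations on codes — the acceptance count of a slice `cntL`, the
empirical gaps and **the selected step** `stepOfL` (first argmax of `|cnt_i - cnt_{i+1}|`), the trial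
verdict `N ≤ 2·G·|c_x - c_y|` and **the candidate verdicts** `stepVerdL`, the digit bit (for `p = 2`:
candidate `0` rejected and candidate `1` accepted) and **the loop state** `LstateL` (the binary value
of the digit bits).

## References

* D. Micciancio, C. Peikert, *Trapdoors for lattices: simpler, tighter, faster, smaller*, EUROCRYPT 2012,
  LNCS 7237; full version IACR ePrint 2011/501, §3, Thm. 3.1 proof (pp. 15–16). [MicciancioPeikert2012]
* S. Arora, B. Barak, *Computational Complexity: A Modern Approach*, CUP 2009, §1.3. [AroraBarak2009]
-/

namespace Literature.Computability.Cryptography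

namespace LWE

namespace MP12

namespace Prog

open _root_.Computability Polynomial Literature.Computability.Complexity Literature.Computability.Complexity.CodeFP

/-! ### Counts and the selected step -/

/-- The bits of the history at positions `[off, off + len)` (`false` beyond the end). [folklore] -/
def bitsAtL (bits : List Bool) (off len : ℕ) : List Bool := (List.range len).map fun i => bits.getD (off + i) false

/-- `bitsAtL` on codes: context `(bits, (off, 1ˡᵉⁿ))`. [cite: AroraBarak2009, §1.3] -/
theorem codeFP_bitsAtL : CodeFP (pairE strE (pairE natE unE)) (rawE bitE) (fun p => bitsAtL p.1 p.2.1 p.2.2) := by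
  have hitem : CodeFP (pairE (pairE strE (pairE natE unE)) natE) bitE (fun t => t.1.1.getD (t.1.2.1 + t.2) false) :=
    strGetDNat.comp ((fst _ _).fst'.pair (natAdd.comp ((fst _ _).snd'.fst'.pair (snd _ _))))
  have hlen := (snd strE (pairE natE unE)).snd'
  exact ((map hitem).comp ((CodeFP.id _).pair ((rangeOf.comp (hlen.pair (natOfUn.comp hlen))).congr fun p => by
    show List.range (min p.2.2 p.2.2) = List.range p.2.2; rw [min_self]))).congr fun p => by obtain ⟨bits, off, len⟩ := p; rfl

/-- The acceptance count of the history positions `[off, off + len)`. [folklore] -/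
def cntL (bits : List Bool) (off len : ℕ) : ℕ := countTrue (bitsAtL bits off len)

/-- `cntL` on codes: context `(bits, (off, 1ˡᵉⁿ))`. [cite: AroraBarak2009, §1.3] -/
theorem codeFP_cntL : CodeFP (pairE strE (pairE natE unE)) natE (fun p => cntL p.1 p.2.1 p.2.2) :=
  (codeFP_countTrue.comp codeFP_bitsAtL).congr fun _ => rfl

/-- The distance of two counts. [folklore] -/
def cdist (a b : ℕ) : ℕ := Int.natAbs ((a : ℤ) - (b : ℤ))

/-- `cdist` on codes. [cite: AroraBarak2009, §1.3] -/
theorem codeFP_cdist : CodeFP (pairE natE natE) natE (fun p => cdist p.1 p.2) :=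
  (intNatAbs.comp (intSub.comp ((intOfNat.comp (fst _ _)).pair (intOfNat.comp (snd _ _))))).congr fun p => by obtain ⟨a, b⟩ := p; rfl

/-- The empirical gaps `|cnt_i - cnt_{i+1}|`, `i < eu`. [cite: MicciancioPeikert2012, Thm. 3.1 proof (p. 15)] -/
def gapsL (bits : List Bool) (eu N' : ℕ) : List ℕ := (List.range eu).map fun i => cdist (cntL bits (i * N') N') (cntL bits ((i + 1) * N') N')

/-- `gapsL` on codes: context `(bits, (1ᵉ, 1ᴺ'))`. [cite: AroraBarak2009, §1.3] -/
theorem codeFP_gapsL : CodeFP (pairE strE (pairE unE unE)) (rawE natE) (fun p => gapsL p.1 p.2.1 p.2.2) := by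
  have hitem : CodeFP (pairE (pairE strE (pairE unE unE)) natE) natE
      (fun t => cdist (cntL t.1.1 (t.2 * t.1.2.2) t.1.2.2) (cntL t.1.1 ((t.2 + 1) * t.1.2.2) t.1.2.2)) := by
    have hb := (fst (pairE strE (pairE unE unE)) natE).fst'
    have hNu := (fst (pairE strE (pairE unE unE)) natE).snd'.snd'
    have hN := natOfUn.comp hNu
    have hi := snd (pairE strE (pairE unE unE)) natE
    exact (codeFP_cdist.comp ((codeFP_cntL.comp (hb.pair ((natMul.comp (hi.pair hN)).pair hNu))).pair
      (codeFP_cntL.comp (hb.pair ((natMul.comp ((natAdd.comp (hi.pair (const _ 1))).pair hN)).pair hNu))))).congr fun _ => rfl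
  exact ((map hitem).comp ((CodeFP.id _).pair ((rangeOf.comp ((snd _ _).fst'.pair (natOfUn.comp (snd _ _).fst'))).congr fun p => by
    show List.range (min p.2.1 p.2.1) = List.range p.2.1; rw [min_self]))).congr fun p => by obtain ⟨bits, eu, N'⟩ := p; rfl

/-- **The selected step**: the first argmax of the empirical gaps. [cite: MicciancioPeikert2012, Thm. 3.1 proof (p. 15)] -/
def stepOfL (bits : List Bool) (eu N' : ℕ) : ℕ := firstArgmax (gapsL bits eu N')

/-- `stepOfL` on codes: context `(bits, (1ᵉ, 1ᴺ'))`. [cite: AroraBarak2009, §1.3] -/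
theorem codeFP_stepOfL : CodeFP (pairE strE (pairE unE unE)) natE (fun p => stepOfL p.1 p.2.1 p.2.2) :=
  (codeFP_firstArgmax.comp codeFP_gapsL).congr fun _ => rfl

/-! ### The candidate verdicts and the loop state -/

/-- The history parameters `(e, (T, (N, (G, nEst))))` (`N` in unary). [folklore] -/
abbrev HPrm : Type := ℕ × (ℕ × (ℕ × (ℕ × ℕ)))

/-- Their code. [folklore] -/
abbrev hprmE : HPrm → List Bool := pairE natE (pairE natE (pairE unE (pairE natE natE)))

/-- The position of the first `x`-verdict of trial `(c, i', k, t)` in the history. [folklore] -/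
def digBase (H : HPrm) (c i' k t : ℕ) : ℕ :=
  H.2.2.2.2 + (c * (H.1 * (2 * (H.2.1 * (2 * H.2.2.1)))) + (i' * (2 * (H.2.1 * (2 * H.2.2.1))) + (k * (H.2.1 * (2 * H.2.2.1)) + t * (2 * H.2.2.1))))

/-- `digBase` on codes: context `(H, (c, (i', (k, t))))`. [cite: AroraBarak2009, §1.3] -/
theorem codeFP_digBase : CodeFP (pairE hprmE (pairE natE (pairE natE (pairE natE natE)))) natE (fun p => digBase p.1 p.2.1 p.2.2.1 p.2.2.2.1 p.2.2.2.2) := by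
  have hH := fst hprmE (pairE natE (pairE natE (pairE natE natE)))
  have he := hH.fst'
  have hT := hH.snd'.fst'
  have hN := natOfUn.comp hH.snd'.snd'.fst'
  have hnEst := hH.snd'.snd'.snd'.snd'
  have hx := snd hprmE (pairE natE (pairE natE (pairE natE natE)))
  have h2N := natMul.comp ((const _ 2).pair hN)
  have hT2N := natMul.comp (hT.pair h2N)
  have hP := natMul.comp ((const _ 2).pair hT2N)
  exact (natAdd.comp (hnEst.pair (natAdd.comp ((natMul.comp (hx.fst'.pair (natMul.comp (he.pair hP)))).pair (natAdd.comp ((natMul.comp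
    (hx.snd'.fst'.pair hP)).pair (natAdd.comp ((natMul.comp (hx.snd'.snd'.fst'.pair hT2N)).pair (natMul.comp (hx.snd'.snd'.snd'.pair h2N)))))))))).congr
    fun p => by obtain ⟨⟨e, T, N, G, nEst⟩, c, i', k, t⟩ := p; rfl

/-- The verdict of one trial: `N ≤ 2·G·|c_x - c_y|`. [cite: MicciancioPeikert2012, Thm. 3.1 proof (p. 16)] -/
def trialOkL (bits : List Bool) (H : HPrm) (base : ℕ) : Bool :=
  decide (H.2.2.1 ≤ 2 * H.2.2.2.1 * cdist (cntL bits base H.2.2.1) (cntL bits (base + H.2.2.1) H.2.2.1))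

/-- `trialOkL` on codes: context `((bits, H), base)`. [cite: AroraBarak2009, §1.3] -/
theorem codeFP_trialOkL : CodeFP (pairE (pairE strE hprmE) natE) bitE (fun p => trialOkL p.1.1 p.1.2 p.2) := by
  have hb := (fst (pairE strE hprmE) natE).fst'
  have hH := (fst (pairE strE hprmE) natE).snd'
  have hNu := hH.snd'.snd'.fst'
  have hN := natOfUn.comp hNu
  have hG := hH.snd'.snd'.snd'.fst'
  have hbase := snd (pairE strE hprmE) natE
  exact (natLe.comp (hN.pair (natMul.comp ((natMul.comp ((const _ 2).pair hG)).pair (codeFP_cdist.comp ((codeFP_cntL.comp (hb.pair (hbase.pair hNu))).pair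
    (codeFP_cntL.comp (hb.pair ((natAdd.comp (hbase.pair hN)).pair hNu))))))))).congr fun p => by obtain ⟨⟨bits, e, T, N, G, nEst⟩, base⟩ := p; rfl

/-- **The verdict of candidate `k` of round `i'` of coordinate `c`**: some trial says `0`.
[cite: MicciancioPeikert2012, Thm. 3.1 proof (p. 16)] -/
def stepVerdL (bits : List Bool) (H : HPrm) (Tu c i' k : ℕ) : Bool :=
  decide (1 ≤ countTrue ((List.range Tu).map fun t => trialOkL bits H (digBase H c i' k t)))

/-- The verdict context `((bits, H), (1ᵀ, (c, (i', k))))`. [folklore] -/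
abbrev verdCtxE : (List Bool × HPrm) × (ℕ × (ℕ × (ℕ × ℕ))) → List Bool := pairE (pairE strE hprmE) (pairE unE (pairE natE (pairE natE natE)))

/-- `stepVerdL` on codes. [cite: AroraBarak2009, §1.3] -/
theorem codeFP_stepVerdL : CodeFP verdCtxE bitE (fun p => stepVerdL p.1.1 p.1.2 p.2.1 p.2.2.1 p.2.2.2.1 p.2.2.2.2) := by
  have hitem : CodeFP (pairE verdCtxE natE) bitE (fun t => trialOkL t.1.1.1 t.1.1.2 (digBase t.1.1.2 t.1.2.2.1 t.1.2.2.2.1 t.1.2.2.2.2 t.2)) := by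
    have hz := fst verdCtxE natE
    exact (codeFP_trialOkL.comp ((hz.fst').pair (codeFP_digBase.comp ((hz.fst'.snd').pair ((hz.snd'.snd'.fst').pair ((hz.snd'.snd'.snd'.fst').pair
      ((hz.snd'.snd'.snd'.snd').pair (snd _ _)))))))).congr fun _ => rfl
  have hTu := (snd (pairE strE hprmE) (pairE unE (pairE natE (pairE natE natE)))).fst'
  have hrange := (rangeOf.comp (hTu.pair (natOfUn.comp hTu))).congr fun p => by
    show List.range (min p.2.1 p.2.1) = List.range p.2.1; rw [min_self]
  exact (natLe.comp ((const _ 1).pair (codeFP_countTrue.comp ((map hitem).comp ((CodeFP.id _).pair hrange))))).congr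
    fun p => by obtain ⟨⟨bits, H⟩, Tu, c, i', k⟩ := p; rfl

/-- **The digit bit of round `i'`** (`p = 2`): candidate `0` rejected and candidate `1` accepted.
[cite: MicciancioPeikert2012, Thm. 3.1 proof (p. 16)] -/
def digitBitL (bits : List Bool) (H : HPrm) (Tu c i' : ℕ) : Bool :=
  if stepVerdL bits H Tu c i' 0 then false else stepVerdL bits H Tu c i' 1

/-- `digitBitL` on codes: context `((bits, H), (1ᵀ, (c, i')))`. [cite: AroraBarak2009, §1.3] -/
theorem codeFP_digitBitL : CodeFP (pairE (pairE strE hprmE) (pairE unE (pairE natE natE))) bitE (fun p => digitBitL p.1.1 p.1.2 p.2.1 p.2.2.1 p.2.2.2) := by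
  have hz := CodeFP.id (pairE (pairE strE hprmE) (pairE unE (pairE natE natE)))
  have hv := fun j : ℕ => codeFP_stepVerdL.comp ((fst _ _).pair ((snd _ _).fst'.pair ((snd _ _).snd'.fst'.pair ((snd (pairE strE hprmE) (pairE unE (pairE natE natE))).snd'.snd'.pair
    (const _ j)))))
  exact ((hv 0).ite (const _ false) (hv 1)).congr fun p => by obtain ⟨⟨bits, H⟩, Tu, c, i'⟩ := p; rfl

/-- **The loop state of coordinate `c` after `n` rounds**: the binary value of the digit bits of rounds
`< min n e`. [cite: MicciancioPeikert2012, Thm. 3.1 proof (p. 16)] -/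
def LstateL (bits : List Bool) (H : HPrm) (Tu eu c n : ℕ) : ℕ := bitsToNat ((List.range (min n eu)).map (digitBitL bits H Tu c))

/-- `LstateL` on codes: context `((bits, H), (1ᵀ, (1ᵉ, (c, n))))`. [cite: AroraBarak2009, §1.3] -/
theorem codeFP_LstateL : CodeFP (pairE (pairE strE hprmE) (pairE unE (pairE unE (pairE natE natE)))) natE
    (fun p => LstateL p.1.1 p.1.2 p.2.1 p.2.2.1 p.2.2.2.1 p.2.2.2.2) := by
  have hitem : CodeFP (pairE (pairE (pairE strE hprmE) (pairE unE (pairE unE (pairE natE natE)))) natE) bitE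
      (fun t => digitBitL t.1.1.1 t.1.1.2 t.1.2.1 t.1.2.2.2.1 t.2) :=
    (codeFP_digitBitL.comp (((fst _ _).fst').pair (((fst _ _).snd'.fst').pair (((fst _ _).snd'.snd'.snd'.fst').pair (snd _ _))))).congr fun _ => rfl
  have hs := snd (pairE strE hprmE) (pairE unE (pairE unE (pairE natE natE)))
  have hrange := rangeOf.comp (hs.snd'.fst'.pair hs.snd'.snd'.snd')
  exact (strVal.comp ((bitsToStr).comp ((map hitem).comp ((CodeFP.id _).pair hrange)))).congr
    fun p => by obtain ⟨⟨bits, H⟩, Tu, eu, c, n⟩ := p; rfl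

end Prog

end MP12

end LWE

end Literature.Computability.Cryptography
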